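import Mathlib
import Summits.NavierStokesRegularity.NavierStokesRegularity.Theses.LerayQuarterDissipation
import HarnessLib

/-!
# `LerayQuarterDissipation.Assembly` — the route's assembly (item stmt-NavierStokesRegularity-22147;
  pure logic)

**Statement.** `EnstrophyQuarterLaw → RecordTimeTypeI → DissipativeZoom → FiniteDissipationLiouville →
NavierStokesRegularity`.

PROOF. The route file `Theses/LerayQuarterDissipation.lean` carries the planner-authored,
kernel-checked deciding theorem `Theses.LerayQuarterDissipation.closes`, whose hypotheses are exactly
the route's two cruxes and two supports and whose conclusion is the sub-problem Statement; the
assembly item is that implication written as ONE proposition, so it is closed by applying `closes`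
to the hypotheses. This proves an IMPLICATION only: the four hypotheses (two of them open cruxes)
remain hypotheses.

HONEST FRAMING: pure logic between the route's own statements; the file does NOT prove
`NavierStokesRegularity` — it proves that the route's four items would imply it.
-/

noncomputable section

set_option linter.dupNamespace false

namespace Summit.NavierStokesRegularity.NavierStokesRegularity.Theorems

open Summit.NavierStokesRegularity.NavierStokesRegularity.Theses.LerayQuarterDissipation in
/-- **Item stmt-NavierStokesRegularity-22147** (`LerayQuarterDissipation.Assembly`): the route's two
cruxes and two supports imply the sub-problem Statement, by the route file's deciding theorem
`closes` (an implication; its hypotheses stay hypotheses). [this file] -/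
theorem lerayQuarterDissipation_assembly_proof :
    Summit.NavierStokesRegularity.NavierStokesRegularity.Theses.LerayQuarterDissipation.Assembly := by
  unfold Summit.NavierStokesRegularity.NavierStokesRegularity.Theses.LerayQuarterDissipation.Assembly
  intro h₁ h₂ h₃ h₄
  exact closes h₁ h₂ h₃ h₄

end Summit.NavierStokesRegularity.NavierStokesRegularity.Theorems

end
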